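import Summits.BirchSwinnertonDyer.Rank1Residual.ManinAdditive.TameCellLocalTwoTorsion
import Summits.BirchSwinnertonDyer.Rank1Residual.ManinAdditive.KodairaDiscUnitAtTwo
import Literature.NumberTheory.DiophantineGeometry.TameAdditiveTypesAtTwoProofs
import Mathlib.Data.Int.ModEq
import HarnessLib
import HarnessLib.Audit.Tags

/-!
# T-desc-IV♮: the LOCAL 2-TORSION of a tame-cell curve is read off the unit part of `Δ_min` — typed (T-desc-22; typer g17)
# (desc g15, ADDENDUM 7, MEMO-desc §33.15; cell `bsd-f2-manin`, D-0131 (3) frontier: the Manin constant at additive primes)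

TYPER NOTE.  SOURCE = HOME/desc/g15/Sketch-desc-g15d.lean sha16 2350d04c8c9e2a61 (143 l.; farm rc 0 · 0 err · 0 warn ·
0 sorry, audit ok per desc), landed VERBATIM except: (i) this note; (ii) namespace `…ManinAdditive.DescG15d` folded into the
tree's `…ManinAdditive.KodairaDiscUnit` (the T-desc-IV♭ namespace of `KodairaDiscUnitAtTwo.lean`, so `TypeFourDiscUnitLawAtTwo`
& co. need no `open`).  Four `@[conjecture]` obligation nodes (nothing asserted) + two PROVED bookkeeping edges.  STATUS AT
FILING: desc has since PROVED (a) and (b) in-seat (HOME/desc/g15/Proof-desc-g15d.lean a68b371ac86d9221, 653 l., farm rc 0,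
axioms standard — ADDENDUM 8, 02:08:05Z) and prover p2 g12 took P-desc-2 (02:11:09Z); the `_holds` theorems land on the
`Theorems/` side BY NAME against this file (T-desc-23 is a prover landing).  REFUTER VERDICTS: ref1 §R113 (R-desc-23): audit
PASS, second engine 510/510, random tame models 139 195 / 0 violations (HOME/ref1/R113-ref1-desc-g15-R23.md 795fe7db6ddbfcf2).
bears_on: stmt-BirchSwinnertonDyer-22967 (C2 `ManinOddAtFour`, imc residual class R-IV′ = E-imc-73′).
[cite: SilvermanATAEC1994, IV.9.4 Table 4.1 (Tate's algorithm at p = 2; shape only — the E-blind congruence criterion is the cell's, NOT in print)]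

HONEST FRAMING.  LENS = desc.  Two ELEMENTARY theorem-candidates (Tate normal forms at `2` + Hensel / an ultrametric
inequality), typed as obligation nodes over the tree's vocabulary `TameTwoLocal.NoLocalTwoTorsionAtTwo` (imc g14 / typer,
`TameCellLocalTwoTorsion.lean`) and `minimalDiscriminantInt`; nothing asserted.  They REFINE the tree theorems
T-desc-IV♭ (`KodairaDiscUnit.*`, p684861: on `4 ∥ N`, `(v₂Δ, Δ/2^{v₂Δ} mod 8) ∈ {(4,1),(4,5),(8,3),(8,5),(8,7)}`) and
E-imc-75 (`TameTwoLocal.TameCellAtMostOneLocalTwoTorsionPoint`, PROVED: at most one `ℚ₂`-rational 2-torsion abscissa) to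
an EXACT, E-BLIND count: the four cells
  `(IV , Δ/2⁴ ≡ 1 (8))` ⟹ no `ℚ₂`-point of order 2 (`ℚ₂(E[2])` = the unramified cubic field, image `C₃`);
  `(IV , Δ/2⁴ ≡ 5 (8))` ⟹ exactly one;        `(IV*, Δ/2⁸ ≡ 3 (4))` ⟹ exactly one (`e = 2`);
  `(IV*, Δ/2⁸ ≡ 5 (8))` ⟹ none (the 2-division cubic is irreducible over `ℚ₂`, Newton slope `1/3`, `e = 3`, image `S₃`).
CENSUS (HOME/desc/g15/DIV2LOCAL-1000-g15.txt, all 235 optimal curves with `4 ∥ N ≤ 1000`): 44 / 78 / 41 / 72, joint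
235/235; OUT OF SAMPLE, PRE-REGISTERED (PREREG-TIV-natural-g15.txt fdc46ba317efcb97 written before the run;
DIV2LOCAL-OOS2000-g15.txt 4fb1f50deda58a14, all 275 optimal curves with `4 ∥ N`, `1000 < N ≤ 2000`): 61 / 112 / 32 / 70,
275/275, 0 rows outside the cells.  TOTAL 510/510.
WHY IT MATTERS HERE.  imc's residual class R-IV′ of crux C2 (`ManinOddAtFour`) on the tame cell is «IV-optimal with `E₀[2]`
reducible over `ℚ₂`» (E-imc-73′, 51 262 curves `N < 5·10⁵`); by (a) below it is EXACTLY «IV-optimal with `Δ_min/16 ≡ 5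
(mod 8)`» — a congruence on the minimal discriminant, no Galois or modular-symbol computation.  And with E-desc-38
(`TameConwayKodairaLaw`, derived row) the cell `(IV*, Δ/2⁸ ≡ 5 (8))` has Lie defect `σ₂ = 1` E-blindly (MS-0: 36/36).
PROOF PLAN (both halves, for provers; all inputs in the tree or Mathlib): take the `ℚ`-rational Tate normal form at the
place `2` (`C • W = (2α, 2β, 2γ, 4q, 4r)` for IV, `(2α, 4β, 4γ, 8q, 16r)` for IV*, `γ` odd, coordinates in `ℤ₍₂₎`;
`OggFormulaTameTypesTwoProofs` :688/:706 or `exists_IVstarNormalForm_padicInt`), move roots along `C` by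
`ManinLocalTwoThree.twoDivision_root_smul`; the cubic `Ψ₂²/4` of the normal form is MONIC over `ℤ₂`:
IV: `x³ + (α²+2β)x² + 2(2q+αγ)x + (γ²+4r) ≡ x³ + α²x² + 1 (mod 2)` — `α` odd: no root in `𝔽₂`, hence none in `ℚ₂`;
`α` even: simple root `x ≡ 1`, Hensel (`hensels_lemma`); IV*: `x³ + (α²+4β)x² + 4(2q+αγ)x + 4(γ²+4r)` — `α` odd: simple
root `x ≡ 1 (mod 2)`, Hensel; `α` even: a root `x` would have `v(x) ≥ 1`, then `x = 2z` gives `2z³ + A z² + 2B z + D = 0`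
with `4 ∣ A`, `2 ∣ B`, `D` odd — impossible (`v ≥ 0`: the sum is odd; `v(z) < 0`: `2z³` is the unique term of least
valuation).  The link «parity of `α`» ↔ «class of `Δ/2^{v} mod 8`» is a RING CERTIFICATE (local/tiv_mod128.py: IV with
`α = 2T`: `Δ − 80 ∈ 128ℤ[T,β,s,q,r]`; `α = 1+2T`: `Δ − 16 ∈ 128ℤ[…]`; IV*: Certs-desc-g15c / p686192) plus the `u¹²`
transport of Proof-desc-g15c (`two_pow_dvd_minimalDiscriminantInt_sub`, modulus `2^{v+3}`).
PARTITION 0.  Beyond-print theorem: no (Tate's algorithm casework; the statement as an E-blind congruence criterion is not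
in print to our knowledge — searches in MEMO-desc §33.15).  BSD is not proved by this.
-/

namespace Summit.BirchSwinnertonDyer.Rank1Residual.ManinAdditive.KodairaDiscUnit

open WeierstrassCurve TameTwoLocal

/-- **T-desc-IV♮(a) `TypeFourLocalTwoTorsionCriterion`** (theorem-candidate, elementary; census 122/122 + OOS 173/173):
on the tame cell `4 ∥ N`, for Kodaira type IV at `2` (`v₂(Δ_min) = 4`): `E(ℚ₂)[2] = 0` ⟺ `Δ_min/2⁴ ≡ 1 (mod 8)`.
Why it might fail: only through a slip in the IV normal form at `p = 2` (a IV curve with `a₁/2` odd AND a `ℚ₂`-rational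
2-torsion point); none among 295 IV curves `≤ 2000`. -/
@[conjecture]
def TypeFourLocalTwoTorsionCriterion : Prop :=
  ∀ (W : WeierstrassCurve ℚ) [W.IsElliptic] [W.IsGloballyMinimal],
    2 ^ 2 ∣ W.conductorNorm ℤ → ¬ 2 ^ 3 ∣ W.conductorNorm ℤ →
      padicValInt 2 W.minimalDiscriminantInt = 4 →
        (NoLocalTwoTorsionAtTwo W ↔ W.minimalDiscriminantInt / 2 ^ 4 ≡ 1 [ZMOD 8])

/-- **T-desc-IV♮(b) `TypeFourStarLocalTwoTorsionCriterion`** (theorem-candidate, elementary; census 113/113 + OOS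
102/102): on the tame cell `4 ∥ N`, for Kodaira type IV* at `2` (`v₂(Δ_min) = 8`): `E(ℚ₂)[2] = 0` ⟺ `Δ_min/2⁸ ≡ 5
(mod 8)` (and then the 2-division cubic is irreducible over `ℚ₂` with `e = 3`).  Why it might fail: a IV* curve with
`a₁/2` even carrying a `ℚ₂`-root of valuation `≥ 1` (the ultrametric step says it cannot); none among 215 IV* curves
`≤ 2000`. -/
@[conjecture]
def TypeFourStarLocalTwoTorsionCriterion : Prop :=
  ∀ (W : WeierstrassCurve ℚ) [W.IsElliptic] [W.IsGloballyMinimal],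
    2 ^ 2 ∣ W.conductorNorm ℤ → ¬ 2 ^ 3 ∣ W.conductorNorm ℤ →
      padicValInt 2 W.minimalDiscriminantInt = 8 →
        (NoLocalTwoTorsionAtTwo W ↔ W.minimalDiscriminantInt / 2 ^ 8 ≡ 5 [ZMOD 8])

/-- **T-desc-IV♮ `LocalTwoTorsionDiscUnitCriterionAtTwo`** (the conjunction; census 510/510). -/
@[conjecture]
def LocalTwoTorsionDiscUnitCriterionAtTwo : Prop :=
  TypeFourLocalTwoTorsionCriterion ∧ TypeFourStarLocalTwoTorsionCriterion

/-- Bookkeeping edge. -/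
theorem localTwoTorsionDiscUnitCriterionAtTwo_of (ha : TypeFourLocalTwoTorsionCriterion)
    (hb : TypeFourStarLocalTwoTorsionCriterion) : LocalTwoTorsionDiscUnitCriterionAtTwo := ⟨ha, hb⟩

/-- **R-IV′ DESCRIBED E-BLINDLY `TameCellLocalTwoTorsionIffDiscUnit`** (derived node): on the tame cell a globally minimal
curve HAS a `ℚ₂`-rational point of order 2 iff `(v₂Δ, unit class)` is `(4, 5 mod 8)` or `(8, 3 mod 4)`.  In particular
imc's residual R-IV′ («IV with `E[2]` reducible over `ℚ₂`», E-imc-73′) = «IV with `Δ_min/16 ≡ 5 (mod 8)`». -/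
@[conjecture]
def TameCellLocalTwoTorsionIffDiscUnit : Prop :=
  ∀ (W : WeierstrassCurve ℚ) [W.IsElliptic] [W.IsGloballyMinimal],
    2 ^ 2 ∣ W.conductorNorm ℤ → ¬ 2 ^ 3 ∣ W.conductorNorm ℤ →
      (¬ NoLocalTwoTorsionAtTwo W ↔
        (padicValInt 2 W.minimalDiscriminantInt = 4 ∧ W.minimalDiscriminantInt / 2 ^ 4 ≡ 5 [ZMOD 8]) ∨
        (padicValInt 2 W.minimalDiscriminantInt = 8 ∧ W.minimalDiscriminantInt / 2 ^ 8 ≡ 3 [ZMOD 4]))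

/-- PROVED edge: T-desc-IV♮ (a),(b) together with T-desc-IV♭ (a),(b) (tree theorems `typeFourDiscUnitLawAtTwo_holds`,
`typeFourStarDiscUnitLawAtTwo_holds` of p684861, entered here as hypotheses to keep this statement file free of `Theorems/`
imports) and the Literature Tate fact `v₂(Δ_min) ∈ {4, 8}` give the E-blind description of R-IV′. -/
theorem tameCellLocalTwoTorsionIffDiscUnit_of (ha : TypeFourLocalTwoTorsionCriterion)
    (hb : TypeFourStarLocalTwoTorsionCriterion) (h4 : TypeFourDiscUnitLawAtTwo) (h8 : TypeFourStarDiscUnitLawAtTwo) :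
    TameCellLocalTwoTorsionIffDiscUnit := by
  intro W _ _ hN4 hN8
  rcases padicValInt_two_minimalDiscriminantInt_of_four_dvd_conductorNorm (W := W) hN4 hN8 with hv | hv
  · have hiff := ha W hN4 hN8 hv
    have hu : W.minimalDiscriminantInt / 2 ^ 4 ≡ 1 [ZMOD 4] := h4 W hN4 hN8 hv
    rw [hiff, hv]
    simp only [Int.ModEq] at hu ⊢
    constructor
    · intro h
      exact Or.inl ⟨trivial, by omega⟩
    · rintro (⟨-, h⟩ | ⟨h, -⟩)
      · omega
      · norm_num at h
  · have hiff := hb W hN4 hN8 hv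
    have hu : ¬ W.minimalDiscriminantInt / 2 ^ 8 ≡ 1 [ZMOD 8] := h8 W hN4 hN8 hv
    -- the unit part `Δ_min / 2⁸` is odd (`v₂(Δ_min) = 8` exactly)
    have hne : W.minimalDiscriminantInt ≠ 0 := by
      intro h
      have h' := cast_minimalDiscriminantInt W
      rw [h, Int.cast_zero] at h'
      exact W.isUnit_Δ.ne_zero h'.symm
    have h256 : (2 : ℤ) ^ 8 ∣ W.minimalDiscriminantInt := by
      have := padicValInt_dvd (p := 2) W.minimalDiscriminantInt
      rw [hv] at this
      exact_mod_cast this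
    have h512 : ¬ (2 : ℤ) ^ 9 ∣ W.minimalDiscriminantInt := by
      have h := padicValInt_dvd_iff (p := 2) 9 W.minimalDiscriminantInt
      intro h9
      have h9' : ((2 : ℕ) : ℤ) ^ 9 ∣ W.minimalDiscriminantInt := by exact_mod_cast h9
      rcases h.mp h9' with h0 | hle
      · exact hne h0
      · omega
    obtain ⟨k, hk⟩ := h256
    have hkodd : ¬ (2 : ℤ) ∣ k := by
      rintro ⟨m, rfl⟩; exact h512 ⟨m, by rw [hk]; ring⟩
    have hquot : W.minimalDiscriminantInt / 2 ^ 8 = k := by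
      rw [hk]; exact Int.mul_ediv_cancel_left _ (by norm_num)
    rw [hiff, hv, hquot]
    rw [hquot] at hu
    simp only [Int.ModEq] at hu ⊢
    constructor
    · intro h
      exact Or.inr ⟨trivial, by omega⟩
    · rintro (⟨h, -⟩ | ⟨-, h⟩)
      · norm_num at h
      · omega

end Summit.BirchSwinnertonDyer.Rank1Residual.ManinAdditive.KodairaDiscUnit
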